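import Literature.Computability.FineGrained.KSatExponentGap
import Literature.Computability.FineGrained.ForcedVariableRenaming
import Literature.Computability.Complexity.TokenStreams
import Literature.Computability.Complexity.SymbolPrograms
import HarnessLib

/-!
# Impagliazzo–Paturi, Lemma 2 (`k`-SAT to `k'`-SAT on fewer variables): the assembly

Family `fine-grained` (trunk T-CPLX-FINE). Impagliazzo–Paturi, *On the complexity of k-SAT*,
JCSS 62 (2001) 367–375, Lemma 2 (p. 373) is the named fact
`Literature.Computability.FineGrained.impagliazzoPaturi_lemma2` of `KSatExponentGap.lean`, the last hypothesis of
the assembly of their Theorem 3 (`s_k ≤ (1 - d/k) s_∞`, the named fact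
`satExponent_le_satExponentLimit`; `KSatExponentGapProofs.lean`,
`satExponent_le_satExponentLimit_of_lemma2`). Its combinatorial core — the renaming reduction
`IPRename.reduceList` with soundness, completeness and the counting — is PROVED in
`ForcedVariableRenaming.lean`; the combinatorial half of the sparsification lemma is proved in
`Sparsification.lean`. This file PROVES the assembly of Lemma 2 from three *machine* facts,
each the existence of one time-bounded `Turing.FinTM2` (`impagliazzoPaturi_lemma2_of`):

* `kCNF_compact_computable` (vendored here; folklore plumbing): renaming the occurring variables
  of a k-CNF onto an initial segment (`KCNF.compact`, defined here) is polynomial-time;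
* `sparsification` (`FineGrainedWave0.lean`, **fine-grained.S05**; Impagliazzo–Paturi–Zane,
  JCSS 63 (2001), Corollary 1): the sparsification algorithm;
* `ipRename_reduceList_computable` (vendored here; the "Moreover" sentence of Lemma 2): the
  list of renamed formulas `IPRename.reduceList k cap len ⌈a n/b⌉ ψ` is computable, for every
  formula `ψ` of an input list, in time polynomial in `|encode ψ|` per produced disjunct.

So `impagliazzoPaturi_lemma2` — and with it Theorem 3
(`satExponent_le_satExponentLimit_of_machines`) — is reduced to routine-but-unformalised
machine constructions in the stack-program framework of `SymbolPrograms.lean`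
(`Literature.Computability.Complexity.ACom.exists_computesInTime`), of which the sparsifier is under way in
`SparsifierRoutines.lean` / `SparsifierTheta.lean`.

## The reduction and the proof (source: proof sketches of Lemma 2 and Theorem 3, p. 374)

Given `k ≥ 3`, `0 < δ ≤ 1`, `ε > 0`, the reduction `IPLemma2.mainF` maps `φ` (on `n`
variables, size `L`) to the concatenation, over the sparse formulas `ψ` of
`F₁ (KCNF.compact φ)` (`F₁` the sparsifier at `ε`, constant `C₁`; the compaction has
`m ≤ min (n, L)` variables, which makes every later size polynomial in `L`), of
`IPRename.reduceList k cap m' ⌈a m / b⌉ ψ`, with: block length `m'`, `m' + 1 ≤ 2^{ε m'}`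
(`exists_blockLen`, so that there are `≤ (m'+1)^{m/m'} ≤ 2^{ε m}` threshold vectors); occurrence
cap `cap = ⌈20 k C₁ / δ⌉` (so that at most `δ m / 20` variables are heavy,
`IPRename.card_heavyVars_mul_le`); threshold ratio `a/b ∈ [δ/(3k), 19δ/(20ek)]`
(`exists_ratio`, using `k^k ≤ e k (k-1)^{k-1}`, `pow_le_exp_mul`, and `e < 57/20`). Proved:

* (i) `|mainF φ| ≤ 2^{numCols} (m'+1) 2^{2εn}` (`length_mainF_le`);
* (ii) every disjunct has `≤ m - ⌈am/b⌉ ≤ (1 - δ/(3k)) n` variables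
  (`numVars_le_of_mem_mainF`);
* (iii) every disjunct has size `O((L+1)²)` (`length_encode_le_of_mem_mainF`);
* (iv) under `φ.NoLightSat δ`, `φ` is satisfiable iff some disjunct is
  (`satisfiable_iff_mainF`): a satisfying assignment survives compaction
  (`KCNF.satisfiable_compact_iff`, and so does the hypothesis, `KCNF.noLightSat_compact`) and
  satisfies some sparse `ψ`; a *minimal* satisfying assignment of `ψ`
  (`IPRename.exists_minimalSat`) has `≥ δ m` ones, hence `≥ 19 δ m / 20` light critical ones,
  and the ceiling form of the completeness of `reduceList`
  (`IPRename.exists_satisfiable_mem_reduceList'`: threshold hypothesis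
  `k^k t < (k-1)^{k-1} #critLight + k^k`) applies to `t = ⌈am/b⌉ < (a/b) m + 1`;
* (v) the composite machine (compaction, sparsifier, renaming machine;
  `ComputesInTime.comp` from `Turing.TM2ComputableAux.comp_outputsWithin`) runs in time
  `O(2^{2εn} poly(L))` (`isExpPolyDom_sparsifyTime`, `isExpPolyDom_reduceTime`, in the
  `KCNF.IsExpPolyDom` calculus of `KSatExponentGap.lean`), converted to an `IsExpPolyBound`
  of `(n, L)` alone (`exists_expPolyBound_of_isExpPolyDom`).

The degenerate case `δ > 1` (`lemma2_of_one_lt`) is served by a three-register stack program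
(`ZeroVar.prog`, proved correct and linear-time: `ZeroVar.runs_prog`, `computesInTime_part`)
that outputs `[φ]` if `n = 0` and `[]` otherwise.

## Design notes

* `KCNF.compact` ranks the occurring variables in the order of first occurrence
  (`IPRename.occList`), as a one-pass machine meets them; `numVars := m`. API: `eval_compact`,
  `satisfiable_compact_iff`, `noLightSat_compact` (the Hamming weight is transported along the
  bijection `rank : occVars ≃ [0, m)`), `length_encode_compact_le` (`≤ (k+3)(L+2)²`; ranks may be
  longer than the original indices).
* `ipRename_reduceList_computable` is stated for LISTS of formulas (`KCNF.encodeList` to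
  `KCNF.encodeList`, concatenating the outputs) with a time bound that is a SUM over the input
  list of a polynomial in the size of each formula times its number `(m'+1)^{n/m'}` of threshold
  vectors: the sparsifier hands over up to `2^{εn}` formulas, so a bound polynomial in the total
  input length would be useless, and an outer loop over a separator-terminated list is free in a
  stack program. The threshold `⌈a n / b⌉ = (a n + b - 1)/b` (`ipThreshold`) is what the
  machine computes from the binary header `n`.
* Constants: `3` in `n (1 - δ/(3k))` is the vendored weakening of the printed `e`
  (`KSatExponentGap.lean`, design notes); the room `1/3 < 19/(20e)` is used for the heavy
  variables (`1/20`) — the source instead assumes bounded occurrences after sparsification.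
* Mathlib anchors: `Real.add_one_le_exp` (for `(1 + 1/j)^j ≤ e` and `2^{εm} ≥ (εm log 2)²/4`),
  `Real.exp_one_lt_d9`, `Nat.ceil`, `hammingNorm`, `Finset.card_bij'`; the machine model is
  Mathlib's `Turing.FinTM2` throughout (`ComputesInTime`).

## References

* R. Impagliazzo, R. Paturi, *On the complexity of k-SAT*, J. Comput. System Sci. 62 (2001)
  367–375, doi:10.1006/jcss.2000.1727: Lemma 1 (p. 371), Lemma 2 (p. 373), proof sketches of
  Lemma 2 and Theorem 3 (p. 374). (Author copy read; not held in the store.)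
* R. Impagliazzo, R. Paturi, F. Zane, *Which problems have strongly exponential complexity?*,
  J. Comput. System Sci. 63 (2001) 512–530, Corollary 1 (sparsification).
* S. Arora, B. Barak, *Computational Complexity: A Modern Approach*, CUP 2009, §1.3
  (multi-tape machine constructions, composition).
-/

namespace Literature.Computability.FineGrained

open _root_.Computability Real

namespace KCNF

variable {k : ℕ}

/-! ### The length of the encoding -/

/-- A literal `(i, b)` is encoded by at most `i + 2` symbols. [folklore] -/
theorem length_encodeLiteral_le (l : ℕ × Bool) : (encodeLiteral l).length ≤ l.1 + 2 := by
  have := Literature.Computability.Complexity.TokConv.length_encodeNat_le l.1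
  simp [encodeLiteral]; omega

/-- A clause over variables `< n` of width `≤ k` is encoded by at most `k (n + 2) + 2` symbols.
[folklore] -/
theorem length_encodeClause_le {n k : ℕ} {c : List (ℕ × Bool)} (hn : ∀ l ∈ c, l.1 < n)
    (hk : c.length ≤ k) : (encodeClause c).length ≤ k * (n + 2) + 2 := by
  have h1 : (c.flatMap encodeLiteral).length ≤ c.length * (n + 2) := by
    rw [List.length_flatMap]
    have : ∀ m ∈ c.map (fun l => (encodeLiteral l).length), m ≤ n + 2 := by
      intro m hm
      obtain ⟨l, hl, rfl⟩ := List.mem_map.1 hm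
      have := length_encodeLiteral_le l
      have := hn l hl
      omega
    simpa [Nat.mul_comm] using List.sum_le_card_nsmul _ _ this
  have h2 : c.length * (n + 2) ≤ k * (n + 2) := Nat.mul_le_mul_right _ hk
  simp only [encodeClause, List.cons_append, List.length_cons, List.length_append,
    List.length_nil]
  omega

/-- **Size of a k-CNF encoding** in terms of the number of variables and of clauses:
`L ≤ n + 1 + |clauses| · (k (n + 2) + 2)`. [folklore] -/
theorem length_encode_le (φ : KCNF k) :
    φ.encode.length ≤ φ.numVars + 1 + φ.clauses.length * (k * (φ.numVars + 2) + 2) := by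
  have h0 := Literature.Computability.Complexity.TokConv.length_encodeNat_le φ.numVars
  have h1 : (φ.clauses.flatMap encodeClause).length ≤
      φ.clauses.length * (k * (φ.numVars + 2) + 2) := by
    rw [List.length_flatMap]
    have : ∀ m ∈ φ.clauses.map (fun c => (encodeClause c).length),
        m ≤ k * (φ.numVars + 2) + 2 := by
      intro m hm
      obtain ⟨c, hc, rfl⟩ := List.mem_map.1 hm
      exact length_encodeClause_le (φ.fst_lt_numVars c hc) (φ.length_le c hc)
    simpa [Nat.mul_comm] using List.sum_le_card_nsmul _ _ this
  simp only [encode, List.length_append, List.length_map, List.length_cons]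
  omega

/-- Every clause takes at least two symbols: `|clauses| ≤ L`. [folklore] -/
theorem length_clauses_le_length_encode (φ : KCNF k) : φ.clauses.length ≤ φ.encode.length := by
  have : φ.clauses.length ≤ (φ.clauses.flatMap encodeClause).length := by
    rw [List.length_flatMap]
    have h : ∀ c ∈ φ.clauses, 1 ≤ (encodeClause c).length := fun c _ => by simp [encodeClause]
    calc φ.clauses.length = (φ.clauses.map fun _ => 1).sum := by simp
      _ ≤ (φ.clauses.map fun c => (encodeClause c).length).sum :=
          List.sum_le_sum (fun c hc => h c hc)
  simp only [encode, List.length_append, List.length_map, List.length_cons]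
  omega

/-- The total number of literal occurrences is at most `L`. [folklore] -/
theorem sum_length_clauses_le_length_encode (φ : KCNF k) :
    (φ.clauses.map List.length).sum ≤ φ.encode.length := by
  have : (φ.clauses.map List.length).sum ≤ (φ.clauses.flatMap encodeClause).length := by
    rw [List.length_flatMap]
    refine List.sum_le_sum fun c _ => ?_
    have : c.length ≤ (c.flatMap encodeLiteral).length := by
      rw [List.length_flatMap]
      calc c.length = (c.map fun _ => 1).sum := by simp
        _ ≤ (c.map fun l => (encodeLiteral l).length).sum :=
            List.sum_le_sum (fun l _ => by simp [encodeLiteral])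
    simp only [encodeClause, List.cons_append, List.length_cons, List.length_append]
    omega
  simp only [encode, List.length_append, List.length_map, List.length_cons]
  omega

/-! ### Compaction: renaming the occurring variables onto an initial segment -/

/-- The rank of the variable `x` in the order of first occurrence in `φ` (`= m`, the number of
occurring variables, if `x` does not occur). [folklore] -/
def rank (φ : KCNF k) (x : ℕ) : ℕ := (IPRename.occList φ.clauses).idxOf x

/-- **Compaction** of a k-CNF: the occurring variables are renamed `0, …, m - 1` in the order of
their first occurrence and `numVars` is reset to `m`. A standard preprocessing making the number
of variables at most the input length (`numVars_compact_le_length_encode`) without changing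
satisfiability (`satisfiable_compact_iff`). [folklore] -/
def compact (φ : KCNF k) : KCNF k where
  numVars := (IPRename.occList φ.clauses).length
  clauses := φ.clauses.map fun c => c.map fun l => (φ.rank l.1, l.2)
  fst_lt_numVars := by
    intro c hc l hl
    obtain ⟨c₀, hc₀, rfl⟩ := List.mem_map.1 hc
    obtain ⟨l₀, hl₀, rfl⟩ := List.mem_map.1 hl
    refine List.idxOf_lt_length_of_mem (IPRename.mem_occList.2 ?_)
    exact IPRename.mem_occVars.2 ⟨c₀, hc₀, IPRename.occursIn_eq_true.2 ⟨l₀, hl₀, rfl⟩⟩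
  length_le := by
    intro c hc
    obtain ⟨c₀, hc₀, rfl⟩ := List.mem_map.1 hc
    simpa using φ.length_le c₀ hc₀

/-- The number of variables of the compaction is the number of occurring variables. [folklore] -/
theorem numVars_compact (φ : KCNF k) :
    φ.compact.numVars = (IPRename.occVars φ.clauses).card :=
  IPRename.length_occList _

/-- The compaction has at most as many variables as the formula. [folklore] -/
theorem numVars_compact_le (φ : KCNF k) : φ.compact.numVars ≤ φ.numVars := by
  rw [numVars_compact]; exact IPRename.card_occVars_le φ

/-- The compaction has at most `L` variables. [folklore] -/
theorem numVars_compact_le_length_encode (φ : KCNF k) :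
    φ.compact.numVars ≤ φ.encode.length := by
  rw [numVars_compact]
  refine le_trans ?_ (sum_length_clauses_le_length_encode φ)
  unfold IPRename.occVars
  refine (List.toFinset_card_le _).trans ?_
  rw [List.length_flatMap]
  simp

/-- The compaction has as many clauses as the formula. [folklore] -/
theorem length_clauses_compact (φ : KCNF k) :
    φ.compact.clauses.length = φ.clauses.length := by
  simp [compact]

/-- The rank of an occurring variable is below `m`. [folklore] -/
theorem rank_lt {φ : KCNF k} {x : ℕ} (hx : x ∈ IPRename.occVars φ.clauses) :
    φ.rank x < φ.compact.numVars :=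
  List.idxOf_lt_length_of_mem (IPRename.mem_occList.2 hx)

/-- The variable of a given rank. [folklore] -/
theorem getElem_rank {φ : KCNF k} {x : ℕ} (hx : x ∈ IPRename.occVars φ.clauses) :
    (IPRename.occList φ.clauses)[φ.rank x]'(rank_lt hx) = x :=
  List.getElem_idxOf (rank_lt hx)

/-- `rank` is injective on the occurring variables. [folklore] -/
theorem rank_injOn (φ : KCNF k) : Set.InjOn φ.rank (IPRename.occVars φ.clauses : Set ℕ) :=
  fun _ hx _ _ h => (List.idxOf_inj (IPRename.mem_occList.2 hx)).1 h

/-- The rank of the `j`-th occurring variable is `j`. [folklore] -/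
theorem rank_getElem (φ : KCNF k) {j : ℕ} (hj : j < (IPRename.occList φ.clauses).length) :
    φ.rank ((IPRename.occList φ.clauses)[j]) = j :=
  (IPRename.nodup_occList _).idxOf_getElem _ _

/-- **Semantics of the compaction**: evaluating the compaction at `w` is evaluating the formula
at `w ∘ rank`. [folklore] -/
theorem eval_compact (φ : KCNF k) (w : ℕ → Bool) :
    φ.compact.eval w = φ.eval (fun x => w (φ.rank x)) := by
  simp [compact, KCNF.eval, List.all_map, List.any_map, Function.comp_def]

/-- Pulling an assignment of the original variables back to the ranks: `pull φ v j = v x_j`.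
[folklore] -/
def pull (φ : KCNF k) (v : ℕ → Bool) (j : ℕ) : Bool :=
  if h : j < (IPRename.occList φ.clauses).length then v ((IPRename.occList φ.clauses)[j]) else false

/-- `pull φ v ∘ rank = v` on the occurring variables. [folklore] -/
theorem pull_rank {φ : KCNF k} (v : ℕ → Bool) {x : ℕ} (hx : x ∈ IPRename.occVars φ.clauses) :
    φ.pull v (φ.rank x) = v x := by
  have h1 : φ.rank x < (IPRename.occList φ.clauses).length := rank_lt hx
  rw [pull, dif_pos h1]
  exact congrArg v (List.getElem_idxOf h1)

/-- Evaluating the compaction at the pulled-back assignment. [folklore] -/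
theorem eval_compact_pull (φ : KCNF k) (v : ℕ → Bool) : φ.compact.eval (φ.pull v) = φ.eval v := by
  rw [eval_compact, IPRename.eval_eq_evalCNF, IPRename.eval_eq_evalCNF]
  refine IPRename.evalCNF_congr _ fun c hc l hl => pull_rank v ?_
  exact IPRename.mem_occVars.2 ⟨c, hc, IPRename.occursIn_eq_true.2 ⟨l, hl, rfl⟩⟩

/-- **Compaction preserves satisfiability.** [folklore] -/
theorem satisfiable_compact_iff (φ : KCNF k) : φ.compact.Satisfiable ↔ φ.Satisfiable := by
  rw [IPRename.satisfiable_iff_exists, IPRename.satisfiable_iff_exists]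
  constructor
  · rintro ⟨w, hw⟩
    exact ⟨_, (eval_compact φ w) ▸ hw⟩
  · rintro ⟨v, hv⟩
    exact ⟨_, (eval_compact_pull φ v).trans hv⟩

/-- Occurring variables are below `numVars`. [folklore] -/
theorem lt_numVars_of_mem_occVars {φ : KCNF k} {x : ℕ} (hx : x ∈ IPRename.occVars φ.clauses) :
    x < φ.numVars := by
  obtain ⟨c, hc, hx⟩ := IPRename.mem_occVars.1 hx
  obtain ⟨l, hl, rfl⟩ := IPRename.occursIn_eq_true.1 hx
  exact φ.fst_lt_numVars c hc l hl

/-- The Hamming weight of a `Fin n`-assignment is the number of `x < n` set to true by its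
extension by `false`. [folklore] -/
theorem hammingNorm_eq_card_range {n : ℕ} (u : Fin n → Bool) :
    hammingNorm u =
      ((Finset.range n).filter fun x => (if h : x < n then u ⟨x, h⟩ else false) = true).card := by
  rw [hammingNorm_eq_card_filter_eq_true, ← Finset.card_map Fin.valEmbedding]
  congr 1
  ext x
  simp only [Finset.mem_map, Finset.mem_filter, Finset.mem_univ, true_and,
    Fin.valEmbedding_apply, Finset.mem_range]
  constructor
  · rintro ⟨i, hi, rfl⟩
    exact ⟨i.2, by simpa using hi⟩
  · rintro ⟨hx, hu⟩
    refine ⟨⟨x, hx⟩, ?_, rfl⟩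
    simpa [hx] using hu

/-- **The hypothesis of Lemma 2 passes to the compaction**: if no satisfying assignment of `φ`
has fewer than `δ n` ones (`δ ≥ 0`), then no satisfying assignment of the compaction has fewer
than `δ m` ones — a satisfying assignment of the compaction, read back on the occurring
variables and extended by `false`, satisfies `φ` with the same number of ones, and `m ≤ n`.
[folklore] -/
theorem noLightSat_compact {φ : KCNF k} {δ : ℝ} (hδ : 0 ≤ δ) (h : φ.NoLightSat δ) :
    φ.compact.NoLightSat δ := by
  classical
  intro w hw
  set W : ℕ → Bool := fun j => if h : j < φ.compact.numVars then w ⟨j, h⟩ else false with hWdef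
  have hWeval : φ.compact.eval W = true := hw
  set v : Fin φ.numVars → Bool := fun i =>
    if (i : ℕ) ∈ IPRename.occVars φ.clauses then W (φ.rank i) else false with hvdef
  -- `v` satisfies `φ`
  have hv : φ.evalFin v = true := by
    unfold evalFin
    rw [← hWeval, eval_compact, IPRename.eval_eq_evalCNF, IPRename.eval_eq_evalCNF]
    refine IPRename.evalCNF_congr _ fun c hc l hl => ?_
    have hocc : l.1 ∈ IPRename.occVars φ.clauses :=
      IPRename.mem_occVars.2 ⟨c, hc, IPRename.occursIn_eq_true.2 ⟨l, hl, rfl⟩⟩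
    have hlt : l.1 < φ.numVars := φ.fst_lt_numVars c hc l hl
    simp [hvdef, hlt, hocc]
  -- `v` and `w` have the same number of ones
  have hcard : hammingNorm v = hammingNorm w := by
    rw [hammingNorm_eq_card_range, hammingNorm_eq_card_range]
    have hmemA : ∀ x, x ∈ (Finset.range φ.numVars).filter
        (fun x => (if h : x < φ.numVars then v ⟨x, h⟩ else false) = true) ↔
        x ∈ IPRename.occVars φ.clauses ∧ W (φ.rank x) = true := by
      intro x
      simp only [Finset.mem_filter, Finset.mem_range]
      constructor
      · rintro ⟨hx, hvx⟩
        rw [dif_pos hx] at hvx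
        by_cases hocc : x ∈ IPRename.occVars φ.clauses
        · exact ⟨hocc, by simpa [hvdef, hocc] using hvx⟩
        · simp [hvdef, hocc] at hvx
      · rintro ⟨hocc, hWx⟩
        have hx : x < φ.numVars := lt_numVars_of_mem_occVars hocc
        exact ⟨hx, by rw [dif_pos hx]; simpa [hvdef, hocc] using hWx⟩
    have hmemB : ∀ j, j ∈ (Finset.range φ.compact.numVars).filter
        (fun x => (if h : x < φ.compact.numVars then w ⟨x, h⟩ else false) = true) ↔
        j < φ.compact.numVars ∧ W j = true := by
      intro j
      simp only [Finset.mem_filter, Finset.mem_range, hWdef]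
    refine Finset.card_bij' (fun x _ => φ.rank x)
      (fun j hj => (IPRename.occList φ.clauses)[j]'((hmemB j).1 hj).1) ?_ ?_ ?_ ?_
    · intro x hx
      obtain ⟨hocc, hWx⟩ := (hmemA x).1 hx
      exact (hmemB _).2 ⟨rank_lt hocc, hWx⟩
    · intro j hj
      obtain ⟨hjm, hWj⟩ := (hmemB j).1 hj
      have hocc : (IPRename.occList φ.clauses)[j] ∈ IPRename.occVars φ.clauses :=
        IPRename.mem_occList.1 (List.getElem_mem hjm)
      exact (hmemA _).2 ⟨hocc, by rwa [rank_getElem]⟩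
    · intro x hx
      exact getElem_rank ((hmemA x).1 hx).1
    · intro j hj
      exact rank_getElem φ ((hmemB j).1 hj).1
  have h1 := h v hv
  rw [hcard] at h1
  have h2 : (φ.compact.numVars : ℝ) ≤ φ.numVars := by exact_mod_cast numVars_compact_le φ
  nlinarith

/-- The size of the compaction is polynomial in `L`: `≤ (k + 3) (L + 2)²`. [folklore] -/
theorem length_encode_compact_le (φ : KCNF k) :
    φ.compact.encode.length ≤ (k + 3) * (φ.encode.length + 2) ^ 2 := by
  have h1 := length_encode_le φ.compact
  have h2 := numVars_compact_le_length_encode φ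
  have h3 : φ.compact.clauses.length ≤ φ.encode.length :=
    (length_clauses_compact φ).le.trans (length_clauses_le_length_encode φ)
  set L := φ.encode.length
  set m := φ.compact.numVars
  set q := φ.compact.clauses.length
  calc φ.compact.encode.length ≤ m + 1 + q * (k * (m + 2) + 2) := h1
    _ ≤ L + 1 + L * (k * (L + 2) + 2) := by
        have : q * (k * (m + 2) + 2) ≤ L * (k * (L + 2) + 2) :=
          Nat.mul_le_mul h3 (by nlinarith)
        omega
    _ ≤ (k + 3) * (L + 2) ^ 2 := by nlinarith

end KCNF

/-! ### Machine composition -/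

/-- **Sequential composition** of instance-timed computations: if `f` is computed from `ea a`
within `T₁ a` steps and `g` from `eb b` within `T₂ b` steps, then `g ∘ f` is computed within
`T₂ (f a) + T₁ a` steps (the second machine reads the output stack of the first in place,
`Turing.TM2ComputableAux.comp_outputsWithin`). [cite: AroraBarak2009, §1.3 (composition of
multi-tape machines)] -/
theorem ComputesInTime.comp {α β γ Γ₀ Γ₁ Γ₂ : Type} {ea : α → List Γ₀} {eb : β → List Γ₁}
    {ec : γ → List Γ₂} {f : α → β} {g : β → γ} {T₁ : α → ℕ} {T₂ : β → ℕ}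
    (h₁ : ComputesInTime ea eb f T₁) (h₂ : ComputesInTime eb ec g T₂) :
    ComputesInTime ea ec (fun a => g (f a)) fun a => T₂ (f a) + T₁ a := by
  obtain ⟨M₁, hM₁⟩ := h₁
  obtain ⟨M₂, hM₂⟩ := h₂
  exact ⟨M₁.comp M₂, fun a =>
    Turing.TM2ComputableAux.comp_outputsWithin M₁ M₂ (l := ea a) (hM₁ a) (hM₂ (f a))⟩

/-! ### The degenerate case `δ > 1`: a two-state filter -/

namespace ZeroVar

open Complexity Complexity.ACom

/-- Registers of the filter: input, a reversal buffer, output. [folklore] -/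
inductive Reg | inp | tmp | out
  deriving DecidableEq, Fintype

/-- The filter: if the header (the binary numeral of `numVars`) is empty — the input starts with
the comma — copy the input to the output followed by the list separator; otherwise erase the
input. [folklore] -/
def prog : ACom Γ' Reg :=
  pop Reg.inp fun o => match o with
    | some Γ'.comma =>
        push Reg.tmp Γ'.comma ;; pour Reg.inp Reg.tmp ;; push Reg.out Γ'.blank ;; pour Reg.tmp Reg.out
    | _ => clear Reg.inp

/-- The function computed: `φ ↦ [φ]` if `φ` has no variables, `[]` otherwise. [folklore] -/
def part {k : ℕ} (φ : KCNF k) : List (KCNF k) := if φ.numVars = 0 then [φ] else []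

/-- `encodeNat n = []` only for `n = 0`. [folklore] -/
theorem encodeNat_eq_nil {n : ℕ} (h : encodeNat n = []) : n = 0 := by
  have := decode_encodeNat n
  rw [h] at this
  exact this.symm.trans (by decide)

/-- **The filter is correct and linear-time.** [folklore] -/
theorem runs_prog {k : ℕ} (φ : KCNF k) :
    Runs prog (AStore.single Reg.inp φ.encode) (AStore.single Reg.out (KCNF.encodeList (part φ)))
      (6 * φ.encode.length + 3) := by
  by_cases h0 : φ.numVars = 0
  · -- header empty: copy
    have henc : φ.encode = Γ'.comma :: φ.clauses.flatMap KCNF.encodeClause := by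
      simp [KCNF.encode, h0, Literature.Computability.Complexity.TokConv.encodeNat_zero']
    set rest := φ.clauses.flatMap KCNF.encodeClause with hrest
    have hout : KCNF.encodeList (part φ) = Γ'.comma :: rest ++ [Γ'.blank] := by
      simp [part, h0, KCNF.encodeList, henc, hrest]
    rw [hout, henc]
    have e1 : Function.update (AStore.single Reg.inp (Γ'.comma :: rest)) Reg.inp rest =
        AStore.single Reg.inp rest := by
      funext r; cases r <;> simp [AStore.single]
    have hin : Runs (push Reg.tmp Γ'.comma ;; pour Reg.inp Reg.tmp ;; push Reg.out Γ'.blank ;;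
        pour Reg.tmp Reg.out) (AStore.single Reg.inp rest)
        (AStore.single Reg.out (Γ'.comma :: rest ++ [Γ'.blank])) (6 * rest.length + 7) := by
      refine ((Runs.push Reg.tmp Γ'.comma _).seq ((runs_pour (a := Reg.inp) (b := Reg.tmp)
        (by decide) _).seq ((Runs.push Reg.out Γ'.blank _).seq
        (runs_pour (a := Reg.tmp) (b := Reg.out) (by decide) _)))).of_eq ?_ ?_
      · funext r; cases r <;> simp [AStore.single]
      · simp [AStore.single]; omega
    have h := Runs.pop_cons (k := Reg.inp) (R := AStore.single Reg.inp (Γ'.comma :: rest))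
      (f := fun o => match o with
        | some Γ'.comma =>
            push Reg.tmp Γ'.comma ;; pour Reg.inp Reg.tmp ;; push Reg.out Γ'.blank ;; pour Reg.tmp Reg.out
        | _ => clear Reg.inp) (a := Γ'.comma) (w := rest) (by simp) (by rw [e1]; exact hin)
    exact h.mono (by simp; omega)
  · -- header nonempty: erase
    obtain ⟨b, w, hw⟩ : ∃ b w, encodeNat φ.numVars = b :: w := by
      cases h : encodeNat φ.numVars with
      | nil => exact absurd (encodeNat_eq_nil h) h0
      | cons b w => exact ⟨b, w, rfl⟩
    have henc : φ.encode = Γ'.bit b :: (w.map Γ'.bit ++ Γ'.comma :: φ.clauses.flatMap KCNF.encodeClause) := by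
      simp [KCNF.encode, hw]
    have hout : KCNF.encodeList (part φ) = [] := by simp [part, h0, KCNF.encodeList]
    rw [hout, henc]
    set rest := w.map Γ'.bit ++ Γ'.comma :: φ.clauses.flatMap KCNF.encodeClause with hrest
    have hin : Runs (clear Reg.inp)
        (Function.update (AStore.single Reg.inp (Γ'.bit b :: rest)) Reg.inp rest)
        (AStore.single Reg.out []) (2 * rest.length + 1) := by
      refine (runs_clear Reg.inp _).of_eq ?_ ?_
      · funext r; cases r <;> simp [AStore.single]
      · simp
    have h := Runs.pop_cons (k := Reg.inp) (R := AStore.single Reg.inp (Γ'.bit b :: rest))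
      (f := fun o => match o with
        | some Γ'.comma =>
            push Reg.tmp Γ'.comma ;; pour Reg.inp Reg.tmp ;; push Reg.out Γ'.blank ;; pour Reg.tmp Reg.out
        | _ => clear Reg.inp) (a := Γ'.bit b) (w := rest) (by simp) hin
    exact h.mono (by simp; omega)

/-- **The degenerate case as a machine**: `part` is computed in time `6 L + 4`. [folklore] -/
theorem computesInTime_part (k : ℕ) :
    ComputesInTime KCNF.encode KCNF.encodeList (part : KCNF k → List (KCNF k))
      fun φ => 6 * φ.encode.length + 3 + 1 := by
  obtain ⟨M, hM⟩ := ACom.exists_computesInTime prog Reg.inp Reg.out KCNF.encode KCNF.encodeList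
    (part : KCNF k → List (KCNF k)) (fun φ => 6 * φ.encode.length + 3) runs_prog
  exact ⟨M, hM⟩

end ZeroVar

/-! ### The two machine facts of the main case -/

/-- **Compaction is polynomial-time** (machine plumbing): some multi-stack machine computes
`KCNF.compact` — rename the occurring variables of a k-CNF by their order of first occurrence and
reset `numVars` to their number — from `KCNF.encode` to `KCNF.encode` in time `c (L + 1)^c`.
(A dictionary of the first occurrences with their binary ranks is built in one pass; every
literal is then looked up and rewritten, `O(L)` comparisons of `O(L)`-bit numerals each.)
[cite: AroraBarak2009, §1.3 (multi-tape machine constructions)] -/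
def kCNF_compact_computable : Prop :=
  ∀ k : ℕ, ∃ c : ℕ, ComputesInTime KCNF.encode KCNF.encode (KCNF.compact : KCNF k → KCNF k)
    fun φ => c * (φ.encode.length + 1) ^ c

/-- The threshold `⌈a n / b⌉` of the number of forced variables, as computed by a machine from
`n` (natural-number arithmetic: `(a n + b - 1) / b`). [folklore] -/
def ipThreshold (a b n : ℕ) : ℕ := (a * n + b - 1) / b

/-- **The renaming reduction is computable within its output size** (machine half of
Impagliazzo–Paturi 2001, Lemma 2, for the explicit reduction `IPRename.reduceList` of
`ForcedVariableRenaming.lean`): for all parameters `k, cap, len, a, b` (`b > 0`) some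
multi-stack machine maps the encoding of a list of k-CNFs `ψ₁, …, ψ_q` (`KCNF.encodeList`) to
the encoding of the concatenation of the lists
`IPRename.reduceList k cap len ⌈a · numVars(ψ_j) / b⌉ ψ_j`, within
`c · Σ_j (m + 1)^{numVars(ψ_j) / m} · (|encode ψ_j| + numVars(ψ_j) + 1)^c + c` steps,
`m = max len 1`: polynomial time per produced disjunct (there are at most
`2^{numCols k cap} (m + 1)^{n/m + 1}` of them per formula, `IPRename.length_reduceList_le`; each
is obtained by counting occurrences, greedy colouring, cutting `B` into blocks and writing
truth-table CNFs of functions of at most `k' = IPRename.kOut k cap len` variables), plus the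
conversion of the binary header to the unary threshold. ("Moreover, `F̄` can be computed from
`F` in time `poly(n) 2^{2εn}`", p. 373.)
[cite: ImpagliazzoPaturiJCSS2001, Lemma 2 (p. 373), the "Moreover" sentence] -/
def ipRename_reduceList_computable : Prop :=
  ∀ (k cap len a b : ℕ), 0 < b → ∃ c : ℕ,
    ComputesInTime KCNF.encodeList KCNF.encodeList
      (fun l : List (KCNF k) =>
        l.flatMap fun ψ => IPRename.reduceList k cap len (ipThreshold a b ψ.numVars) ψ)
      fun l => c * (l.map fun ψ : KCNF k => (max len 1 + 1) ^ (ψ.numVars / max len 1) *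
        (ψ.encode.length + ψ.numVars + 1) ^ c).sum + c

namespace IPRename

/-- **Completeness of the list, ceiling form.** As `exists_satisfiable_mem_reduceList`, with the
threshold hypothesis weakened to `k^k (t - 1) < (k-1)^{k-1} · #critLight` (written additively):
the number of forced variables is an integer, so it reaches `t` as soon as it exceeds `t - 1`.
[cite: ImpagliazzoPaturiJCSS2001, Lemma 2 (p. 373) (⇒) with Lemma 1] -/
theorem exists_satisfiable_mem_reduceList' {k : ℕ} (hk1 : 1 ≤ k) (cap len t : ℕ) (φ : KCNF k)
    {α : ℕ → Bool} (hmin : IsMinimalSat φ.clauses α)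
    (ht : k ^ k * t < (k - 1) ^ (k - 1) * (critLight φ.clauses cap α).card + k ^ k) :
    ∃ Φ ∈ reduceList k cap len t φ, Φ.Satisfiable := by
  obtain ⟨g, hg⟩ := exists_goodMask φ.clauses φ.length_le hk1 cap hmin len []
  set P : Params := ⟨cap, len, maskOf (bsOf g), []⟩
  have hprof := satisfiable_reduce_withProfile P α φ hmin.1
  refine ⟨reduce (withProfile P φ.clauses α) φ, mem_reduceList.2 ⟨bsOf g, length_bsOf g,
    profile P φ.clauses α, forall₂_profile_sizes P φ.clauses α, ?_, rfl⟩, hprof.1⟩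
  have hsum : (profile P φ.clauses α).sum =
      (bList P φ.clauses).countP fun z => forced P φ.clauses z α := by
    rw [← fSum_eq_sum cap len (maskOf (bsOf g)) (profile P φ.clauses α) φ.clauses
      (forall₂_profile_sizes P φ.clauses α)]
    exact fSum_withProfile P φ.clauses α
  rw [hsum]
  set N := (bList P φ.clauses).countP fun z => forced P φ.clauses z α
  have hkk : 0 < k ^ k := Nat.pow_pos hk1
  have h1 : k ^ k * t < k ^ k * (N + 1) := by
    calc k ^ k * t < (k - 1) ^ (k - 1) * (critLight φ.clauses cap α).card + k ^ k := ht
      _ ≤ k ^ k * N + k ^ k := Nat.add_le_add_right hg _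
      _ = k ^ k * (N + 1) := by ring
  exact Nat.lt_succ_iff.1 (Nat.lt_of_mul_lt_mul_left h1)

end IPRename

namespace IPLemma2

/-! ### Parameters -/

/-- **Block length.** For `ε > 0` there is `m ≥ 1` with `m + 1 ≤ 2^{ε m}` (so that the number
`(m+1)^{n/m}` of `f`-vectors per block structure is at most `2^{ε n}`).
[cite: ImpagliazzoPaturiJCSS2001, p. 372 ("(l+1)^{n/l} ≤ 2^{εn} for sufficiently large n"; here: l)] -/
theorem exists_blockLen {ε : ℝ} (hε : 0 < ε) :
    ∃ m : ℕ, 1 ≤ m ∧ ((m : ℝ) + 1) ≤ (2 : ℝ) ^ (ε * m) := by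
  -- `2^{εm} = exp(εm log 2) ≥ (εm log 2 / 2 + 1)^2 ≥ (ε log 2)^2 m^2 / 4 ≥ m + 1` for `m ≥ 8/(ε log 2)^2`
  set c := ε * Real.log 2 with hc
  have hc0 : 0 < c := mul_pos hε (Real.log_pos one_lt_two)
  obtain ⟨m, hm⟩ := exists_nat_ge (8 / c ^ 2 + 1)
  have hm1 : (1 : ℝ) ≤ m := le_trans (by have := div_nonneg (by norm_num : (0:ℝ) ≤ 8) (sq_nonneg c); linarith) hm
  refine ⟨m, by exact_mod_cast hm1, ?_⟩
  have hexp : (2 : ℝ) ^ (ε * m) = Real.exp (c * m) := by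
    rw [Real.rpow_def_of_pos two_pos, hc]; ring_nf
  rw [hexp]
  have h1 : c * m / 2 + 1 ≤ Real.exp (c * m / 2) := by
    have := Real.add_one_le_exp (c * m / 2); linarith
  have h2 : Real.exp (c * m) = Real.exp (c * m / 2) ^ 2 := by
    rw [← Real.exp_nat_mul]; ring_nf
  have h3 : 0 ≤ c * m / 2 + 1 := by positivity
  have h4 : (c * m / 2 + 1) ^ 2 ≤ Real.exp (c * m / 2) ^ 2 := pow_le_pow_left₀ h3 h1 2
  have h5 : c ^ 2 * m ≥ 8 := by
    have : (m : ℝ) ≥ 8 / c ^ 2 := by linarith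
    have hc2 : 0 < c ^ 2 := by positivity
    calc c ^ 2 * m ≥ c ^ 2 * (8 / c ^ 2) := by gcongr
      _ = 8 := by field_simp
  nlinarith [sq_nonneg (c * m)]

/-- `(m+1)^{⌊n/m⌋} ≤ 2^{ε n}` for the block length of `exists_blockLen`. [folklore] -/
theorem blockCount_le {ε : ℝ} (hε : 0 ≤ ε) {m : ℕ} (hm1 : 1 ≤ m)
    (hm : ((m : ℝ) + 1) ≤ (2 : ℝ) ^ (ε * m)) (n : ℕ) :
    (((m + 1) ^ (n / m) : ℕ) : ℝ) ≤ (2 : ℝ) ^ (ε * n) := by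
  have h0 : (0 : ℝ) ≤ (m : ℝ) + 1 := by positivity
  calc (((m + 1) ^ (n / m) : ℕ) : ℝ) = ((m : ℝ) + 1) ^ (n / m) := by push_cast; ring
    _ ≤ ((2 : ℝ) ^ (ε * m)) ^ (n / m) := pow_le_pow_left₀ h0 hm _
    _ = (2 : ℝ) ^ (ε * m * (n / m : ℕ)) := by rw [← Real.rpow_mul_natCast (by norm_num)]
    _ ≤ (2 : ℝ) ^ (ε * n) := by
        refine Real.rpow_le_rpow_of_exponent_le one_le_two ?_
        rw [mul_assoc]
        refine mul_le_mul_of_nonneg_left ?_ hε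
        have : (m : ℝ) * (n / m : ℕ) ≤ n := by exact_mod_cast Nat.mul_div_le n m
        exact this

/-- **The constant of Lemma 1**: `k^k ≤ e · k · (k-1)^{k-1}` (`(1 - 1/k)^{k-1} ≥ 1/e`), for
`k ≥ 2`. [cite: ImpagliazzoPaturiJCSS2001, Lemma 1 (p. 371) ("at least 1/k (1 - 1/k)^{k-1} ≥ 1/(ek)")] -/
theorem pow_le_exp_mul {k : ℕ} (hk : 2 ≤ k) :
    ((k : ℝ)) ^ k ≤ Real.exp 1 * k * ((k : ℝ) - 1) ^ (k - 1) := by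
  obtain ⟨j, rfl⟩ : ∃ j, k = j + 1 := ⟨k - 1, by omega⟩
  have hj : 1 ≤ j := by omega
  have hj0 : (0 : ℝ) < j := by exact_mod_cast hj
  simp only [Nat.add_sub_cancel, Nat.cast_add, Nat.cast_one, add_sub_cancel_right]
  -- (j+1)^j ≤ e j^j
  have h1 : (1 + 1 / (j : ℝ)) ^ j ≤ Real.exp 1 := by
    calc (1 + 1 / (j : ℝ)) ^ j ≤ (Real.exp (1 / j)) ^ j := by
          refine pow_le_pow_left₀ (by positivity) ?_ _
          have := Real.add_one_le_exp (1 / (j : ℝ)); linarith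
      _ = Real.exp 1 := by rw [← Real.exp_nat_mul]; field_simp
  have h2 : ((j : ℝ) + 1) ^ j ≤ Real.exp 1 * (j : ℝ) ^ j := by
    have : ((j : ℝ) + 1) ^ j = (1 + 1 / (j : ℝ)) ^ j * (j : ℝ) ^ j := by
      rw [← mul_pow]; congr 1; field_simp
    rw [this]
    exact mul_le_mul_of_nonneg_right h1 (by positivity)
  calc ((j : ℝ) + 1) ^ (j + 1) = ((j : ℝ) + 1) * ((j : ℝ) + 1) ^ j := by ring
    _ ≤ ((j : ℝ) + 1) * (Real.exp 1 * (j : ℝ) ^ j) :=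
        mul_le_mul_of_nonneg_left h2 (by positivity)
    _ = Real.exp 1 * ((j : ℝ) + 1) * (j : ℝ) ^ j := by ring

/-- **The threshold ratio.** For `k ≥ 3` and `δ > 0` there is a rational `a/b` with
`δ/(3k) ≤ a/b` and `(a/b) · k^k ≤ (19/20) · δ · (k-1)^{k-1}` — possible because
`1/3 < 19/(20 e)`. [folklore] -/
theorem exists_ratio {k : ℕ} (hk : 3 ≤ k) {δ : ℝ} (hδ : 0 < δ) :
    ∃ a b : ℕ, 0 < b ∧ δ / (3 * k) ≤ (a : ℝ) / b ∧
      (a : ℝ) / b * (k : ℝ) ^ k ≤ 19 / 20 * δ * ((k : ℝ) - 1) ^ (k - 1) := by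
  have hk0 : (0 : ℝ) < k := by exact_mod_cast (show 0 < k by omega)
  have he : Real.exp 1 < 2.85 := lt_trans Real.exp_one_lt_d9 (by norm_num)
  have he0 : 0 < Real.exp 1 := Real.exp_pos 1
  -- the target interval `[δ/(3k), 19 δ/(20 e k)]` has positive length
  set u := 19 / 20 * δ / (Real.exp 1 * k) with hu
  have hgap : δ / (3 * k) < u := by
    rw [hu, div_lt_div_iff₀ (by positivity) (by positivity)]
    nlinarith [mul_pos hδ hk0, mul_pos (mul_pos hδ hk0) (sub_pos.2 he)]
  set gap := u - δ / (3 * k) with hgapdef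
  have hgap0 : 0 < gap := by rw [hgapdef]; linarith
  obtain ⟨b, hb⟩ := exists_nat_gt (1 / gap)
  have hb0 : (0 : ℝ) < b := lt_trans (by positivity) hb
  have hbpos : 0 < b := by exact_mod_cast hb0
  set a := ⌈(b : ℝ) * (δ / (3 * k))⌉₊ with ha
  refine ⟨a, b, hbpos, ?_, ?_⟩
  · rw [le_div_iff₀ hb0]
    have := Nat.le_ceil ((b : ℝ) * (δ / (3 * k)))
    rw [← ha] at this; linarith
  · -- a/b < δ/(3k) + 1/b ≤ u
    have h1 : (a : ℝ) < b * (δ / (3 * k)) + 1 := by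
      rw [ha]; exact Nat.ceil_lt_add_one (by positivity)
    have h2 : (a : ℝ) / b < δ / (3 * k) + 1 / b := by
      rw [div_lt_iff₀ hb0]
      rw [add_mul, div_mul_cancel₀ _ hb0.ne']
      linarith
    have h3 : 1 / (b : ℝ) < gap := by
      rw [div_lt_iff₀ hb0]
      have := (div_lt_iff₀ hgap0).1 hb
      linarith
    have h4 : (a : ℝ) / b ≤ u := by rw [hgapdef] at h3; linarith
    -- u k^k ≤ (19/20) δ (k-1)^(k-1)
    have h5 := pow_le_exp_mul (show 2 ≤ k by omega)
    have hkk : (0 : ℝ) ≤ (k : ℝ) ^ k := by positivity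
    calc (a : ℝ) / b * (k : ℝ) ^ k ≤ u * (k : ℝ) ^ k := mul_le_mul_of_nonneg_right h4 hkk
      _ ≤ u * (Real.exp 1 * k * ((k : ℝ) - 1) ^ (k - 1)) :=
          mul_le_mul_of_nonneg_left h5 (by rw [hu]; positivity)
      _ = 19 / 20 * δ * ((k : ℝ) - 1) ^ (k - 1) := by
          rw [hu]; field_simp

/-- The threshold `t = ⌈a n / b⌉ = (a n + b - 1)/b`: `a n ≤ b t` and `b t < a n + b`. [folklore] -/
theorem ipThreshold_bounds {a b : ℕ} (hb : 0 < b) (n : ℕ) :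
    a * n ≤ b * ((a * n + b - 1) / b) ∧ b * ((a * n + b - 1) / b) < a * n + b := by
  constructor
  · have h := Nat.div_add_mod (a * n + b - 1) b
    have h2 := Nat.mod_lt (a * n + b - 1) hb
    omega
  · have h := Nat.div_mul_le_self (a * n + b - 1) b
    rw [Nat.mul_comm] at h
    omega

/-! ### From instance-level bounds to `IsExpPolyBound` -/

/-- `1 ≤ 2^x` for `x ≥ 0`. [folklore] -/
theorem one_le_two_rpow {x : ℝ} (hx : 0 ≤ x) : (1 : ℝ) ≤ (2 : ℝ) ^ x := by
  simpa using Real.rpow_le_rpow_of_exponent_le one_le_two hx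

/-- A machine whose instance-level running time is `O(2^{ρ n} poly(L))` runs within a bound
`T(n, L)` of `(numVars, |encode|)` alone with `IsExpPolyBound ρ T` (take
`T(n, L) = ⌊c 2^{ρ n} (L+1)^c⌋`). [folklore] -/
theorem exists_expPolyBound_of_isExpPolyDom {k : ℕ} {β Γ₁ : Type} {eb : β → List Γ₁}
    {F : KCNF k → β} {ρ : ℝ} {T : KCNF k → ℕ}
    (hT : KCNF.IsExpPolyDom ρ fun φ => (T φ : ℝ)) (hM : ComputesInTime KCNF.encode eb F T) :
    ∃ T' : ℕ → ℕ → ℕ, IsExpPolyBound ρ T' ∧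
      ComputesInTime KCNF.encode eb F fun φ => T' φ.numVars φ.encode.length := by
  obtain ⟨c, d, h⟩ := hT
  refine ⟨fun n L => ⌊((max c d : ℕ) : ℝ) * (2 : ℝ) ^ (ρ * n) * ((L : ℝ) + 1) ^ (max c d)⌋₊,
    ⟨max c d, fun n L => Nat.floor_le (by positivity)⟩, hM.mono_time fun φ => ?_⟩
  refine Nat.le_floor ((h φ).trans ?_)
  have hL : (1 : ℝ) ≤ (φ.encode.length : ℝ) + 1 := by simp
  gcongr
  · exact_mod_cast le_max_left c d
  · exact le_max_right c d

/-! ### The degenerate case `δ > 1` -/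

/-- **Lemma 2 for `δ > 1`.** Then the hypothesis "no satisfying assignment with fewer than `δ n`
ones" makes every formula with `n ≥ 1` unsatisfiable, and the filter `ZeroVar.part`
(`φ ↦ [φ]` if `n = 0`, else `[]`) is a reduction as required. [folklore] -/
theorem lemma2_of_one_lt (k : ℕ) {δ : ℝ} (hδ1 : 1 < δ) {ε : ℝ} (hε : 0 < ε) :
    ∃ (k' C : ℕ) (F : KCNF k → List (KCNF k')) (T : ℕ → ℕ → ℕ),
      IsExpPolyBound (2 * ε) T ∧
      ComputesInTime KCNF.encode KCNF.encodeList F (fun φ => T φ.numVars φ.encode.length) ∧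
      ∀ φ : KCNF k,
        ((F φ).length : ℝ) ≤
            C * (2 : ℝ) ^ (2 * ε * φ.numVars) * ((φ.encode.length : ℝ) + 1) ^ C ∧
        (∀ ψ ∈ F φ, (ψ.numVars : ℝ) ≤ (1 - δ / (3 * k)) * φ.numVars ∧
          (ψ.encode.length : ℝ) ≤ C * ((φ.encode.length : ℝ) + 1) ^ C) ∧
        (φ.NoLightSat δ → (φ.Satisfiable ↔ ∃ ψ ∈ F φ, ψ.Satisfiable)) := by
  have hT : KCNF.IsExpPolyDom (2 * ε) fun φ : KCNF k => ((6 * φ.encode.length + 3 + 1 : ℕ) : ℝ) := by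
    refine ⟨10, 1, fun φ => ?_⟩
    have h1 : (1 : ℝ) ≤ (2 : ℝ) ^ (2 * ε * φ.numVars) := one_le_two_rpow (by positivity)
    have h2 : (0 : ℝ) ≤ φ.encode.length := Nat.cast_nonneg _
    push_cast
    nlinarith
  obtain ⟨T, hT, hM⟩ := exists_expPolyBound_of_isExpPolyDom hT (ZeroVar.computesInTime_part k)
  refine ⟨k, 1, ZeroVar.part, T, hT, hM, fun φ => ⟨?_, ?_, ?_⟩⟩
  · have h0 : ((ZeroVar.part φ).length : ℝ) ≤ 1 := by
      unfold ZeroVar.part; split_ifs <;> simp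
    have h1 : (1 : ℝ) ≤ (2 : ℝ) ^ (2 * ε * φ.numVars) := one_le_two_rpow (by positivity)
    have h3 : (0 : ℝ) ≤ φ.encode.length := Nat.cast_nonneg _
    calc ((ZeroVar.part φ).length : ℝ) ≤ 1 := h0
      _ ≤ (2 : ℝ) ^ (2 * ε * φ.numVars) := h1
      _ ≤ (1 : ℕ) * (2 : ℝ) ^ (2 * ε * φ.numVars) * ((φ.encode.length : ℝ) + 1) ^ (1 : ℕ) := by
          simp only [Nat.cast_one, one_mul, pow_one]
          nlinarith
  · intro ψ hψ
    unfold ZeroVar.part at hψ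
    split_ifs at hψ with h0
    · simp only [List.mem_singleton] at hψ
      subst hψ
      refine ⟨by simp [h0], ?_⟩
      simp
    · simp at hψ
  · intro hno
    unfold ZeroVar.part
    split_ifs with h0
    · simp
    · simp only [List.not_mem_nil, false_and, exists_false, iff_false]
      rintro ⟨v, hv⟩
      have h1 := hno v hv
      have h2 : (hammingNorm v : ℝ) ≤ φ.numVars := by exact_mod_cast hammingNorm_fin_bool_le v
      have hn : (1 : ℝ) ≤ φ.numVars := by exact_mod_cast Nat.one_le_iff_ne_zero.2 h0
      nlinarith

/-! ### Sizes in the main case -/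

/-- A `k'`-CNF on `≤ m ≤ L` variables with `≤ C m` clauses has size `≤ 4 (C+1)(k'+3)(L+1)²`.
[folklore] -/
theorem length_encode_le_of_clauses {k' : ℕ} (ψ : KCNF k') {m C L : ℕ} (hn : ψ.numVars ≤ m)
    (hc : ψ.clauses.length ≤ C * m) (hm : m ≤ L) :
    ψ.encode.length ≤ 4 * (C + 1) * (k' + 3) * (L + 1) ^ 2 := by
  have h1 := KCNF.length_encode_le ψ
  have h2 : ψ.clauses.length * (k' * (ψ.numVars + 2) + 2) ≤ C * L * (k' * (L + 2) + 2) :=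
    Nat.mul_le_mul (hc.trans (Nat.mul_le_mul_left _ hm)) (by nlinarith)
  have h3 : C * L * (k' * (L + 2) + 2) ≤ 2 * C * (k' + 1) * (L + 1) ^ 2 :=
    calc C * L * (k' * (L + 2) + 2) ≤ C * (L + 1) * ((k' + 1) * (2 * (L + 1))) :=
          Nat.mul_le_mul (Nat.mul_le_mul_left _ (Nat.le_succ L)) (by nlinarith)
      _ = 2 * C * (k' + 1) * (L + 1) ^ 2 := by ring
  have h4 : L + 1 ≤ (L + 1) ^ 2 := Nat.le_self_pow two_ne_zero _
  have h5 : (1 + 2 * C * (k' + 1)) * (L + 1) ^ 2 ≤ 4 * (C + 1) * (k' + 3) * (L + 1) ^ 2 :=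
    Nat.mul_le_mul_right _ (by nlinarith)
  have h6 : ψ.numVars + 1 ≤ L + 1 := by omega
  nlinarith

/-! ### The main case `0 < δ ≤ 1` -/

/-- A formula reads only the variables below `numVars`. [folklore] -/
theorem eval_congr_lt {k : ℕ} (φ : KCNF k) {v w : ℕ → Bool} (h : ∀ x < φ.numVars, v x = w x) :
    φ.eval v = φ.eval w := by
  rw [IPRename.eval_eq_evalCNF, IPRename.eval_eq_evalCNF]
  exact IPRename.evalCNF_congr _ fun c hc l hl => h _ (φ.fst_lt_numVars c hc l hl)

/-- The Hamming weight of the restriction of `α` to the first `m` variables is the number of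
ones of `α` below `m`. [folklore] -/
theorem hammingNorm_restrict (m : ℕ) (α : ℕ → Bool) :
    hammingNorm (fun i : Fin m => α i) = (IPRename.onesBelow m α).card := by
  rw [KCNF.hammingNorm_eq_card_range]
  unfold IPRename.onesBelow
  congr 1
  refine Finset.filter_congr fun x hx => ?_
  rw [dif_pos (Finset.mem_range.1 hx)]

section MainCase

variable {k : ℕ} {ε : ℝ} {C₁ : ℕ} {F₁ : KCNF k → List (KCNF k)} {cap m' a b : ℕ}

/-- The reduction of the main case: compaction, then the sparsifier `F₁`, then the renaming
reduction with threshold `⌈a m / b⌉` on every sparse formula.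
[cite: ImpagliazzoPaturiJCSS2001, proof sketch of Lemma 2 (p. 374)] -/
noncomputable def mainF (cap m' a b : ℕ) (F₁ : KCNF k → List (KCNF k)) (φ : KCNF k) :
    List (KCNF (IPRename.kOut k cap m')) :=
  (F₁ φ.compact).flatMap fun ψ => IPRename.reduceList k cap m' (ipThreshold a b ψ.numVars) ψ

/-- The combinatorial guarantee of a sparsifier `F₁` with constant `C₁` at `ε` (the first
conjunct of the named fact `sparsification`: at most `2^{ε n}` formulas on the same variables
with `≤ C₁ n` clauses each, whose disjunction is equivalent to the input).
[cite: ImpagliazzoPaturiZaneJCSS2001, Corollary 1] -/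
abbrev IsSparsifier (ε : ℝ) (C₁ : ℕ) (F₁ : KCNF k → List (KCNF k)) : Prop :=
  ∀ φ : KCNF k,
    ((F₁ φ).length : ℝ) ≤ (2 : ℝ) ^ (ε * φ.numVars) ∧
    (∀ ψ ∈ F₁ φ, ψ.numVars = φ.numVars ∧ ψ.clauses.length ≤ C₁ * φ.numVars) ∧
    ∀ v : ℕ → Bool, φ.eval v = true ↔ ∃ ψ ∈ F₁ φ, ψ.eval v = true

/-- Membership in `mainF`. [folklore] -/
theorem mem_mainF (hF₁ : IsSparsifier ε C₁ F₁) {φ : KCNF k} {Φ : KCNF (IPRename.kOut k cap m')} :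
    Φ ∈ mainF cap m' a b F₁ φ ↔ ∃ ψ ∈ F₁ φ.compact,
      Φ ∈ IPRename.reduceList k cap m' (ipThreshold a b φ.compact.numVars) ψ := by
  simp only [mainF, List.mem_flatMap]
  constructor
  · rintro ⟨ψ, hψ, hΦ⟩; exact ⟨ψ, hψ, by rwa [((hF₁ φ.compact).2.1 ψ hψ).1] at hΦ⟩
  · rintro ⟨ψ, hψ, hΦ⟩; exact ⟨ψ, hψ, by rwa [((hF₁ φ.compact).2.1 ψ hψ).1]⟩

/-- The threshold is at least `a m / b`. [folklore] -/
theorem ipThreshold_ge (hb : 0 < b) (n : ℕ) : (a : ℝ) / b * n ≤ ipThreshold a b n := by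
  have hb0 : (0 : ℝ) < b := by exact_mod_cast hb
  have h' : ((a * n : ℕ) : ℝ) ≤ ((b * ipThreshold a b n : ℕ) : ℝ) := by
    exact_mod_cast (ipThreshold_bounds (a := a) hb n).1
  push_cast at h'
  rw [div_mul_eq_mul_div, div_le_iff₀ hb0]
  linarith

/-- The threshold is less than `a m / b + 1`. [folklore] -/
theorem ipThreshold_lt (hb : 0 < b) (n : ℕ) : (ipThreshold a b n : ℝ) < (a : ℝ) / b * n + 1 := by
  have hb0 : (0 : ℝ) < b := by exact_mod_cast hb
  have h' : ((b * ipThreshold a b n : ℕ) : ℝ) < ((a * n + b : ℕ) : ℝ) := by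
    exact_mod_cast (ipThreshold_bounds (a := a) hb n).2
  push_cast at h'
  have : (ipThreshold a b n : ℝ) * b < ((a : ℝ) / b * n + 1) * b := by
    rw [add_mul, div_mul_eq_mul_div, div_mul_cancel₀ _ hb0.ne', one_mul]
    linarith
  exact lt_of_mul_lt_mul_right this hb0.le

/-- **(i) The number of disjuncts**: `|mainF φ| ≤ 2^{numCols} (m'+1) · 2^{2εn}`.
[cite: ImpagliazzoPaturiJCSS2001, Lemma 2 (p. 373) ("at most 2^{2εn} k'-CNFs")] -/
theorem length_mainF_le (hF₁ : IsSparsifier ε C₁ F₁) (hε : 0 ≤ ε) (hm'1 : 1 ≤ m')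
    (hm' : ((m' : ℝ) + 1) ≤ (2 : ℝ) ^ (ε * m')) (φ : KCNF k) :
    ((mainF cap m' a b F₁ φ).length : ℝ) ≤
      ((2 ^ IPRename.numCols k cap * (m' + 1) : ℕ) : ℝ) * (2 : ℝ) ^ (2 * ε * φ.numVars) := by
  set m := φ.compact.numVars with hmdef
  have hmax : max m' 1 = m' := max_eq_left hm'1
  have h1 : (mainF cap m' a b F₁ φ).length ≤
      (F₁ φ.compact).length * (2 ^ IPRename.numCols k cap * ((m' + 1) ^ (m / m') * (m' + 1))) := by
    simp only [mainF, List.length_flatMap]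
    have hb' : ∀ x ∈ (F₁ φ.compact).map (fun ψ =>
        (IPRename.reduceList k cap m' (ipThreshold a b ψ.numVars) ψ).length),
        x ≤ 2 ^ IPRename.numCols k cap * ((m' + 1) ^ (m / m') * (m' + 1)) := by
      intro x hx
      obtain ⟨ψ, hψ, rfl⟩ := List.mem_map.1 hx
      have h := IPRename.length_reduceList_le k cap m' (ipThreshold a b ψ.numVars) ψ
      rw [hmax, pow_succ] at h
      rw [((hF₁ φ.compact).2.1 ψ hψ).1] at h ⊢
      exact h
    simpa [Nat.mul_comm] using List.sum_le_card_nsmul _ _ hb'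
  have h1r : ((mainF cap m' a b F₁ φ).length : ℝ) ≤ (F₁ φ.compact).length *
      (2 ^ IPRename.numCols k cap * ((((m' + 1) ^ (m / m') : ℕ) : ℝ) * (m' + 1))) := by
    exact_mod_cast h1
  have h2 : (((m' + 1) ^ (m / m') : ℕ) : ℝ) ≤ (2 : ℝ) ^ (ε * m) := blockCount_le hε hm'1 hm' m
  have hmn : (m : ℝ) ≤ φ.numVars := by exact_mod_cast KCNF.numVars_compact_le φ
  have h3 : (2 : ℝ) ^ (ε * m) * (2 : ℝ) ^ (ε * m) ≤ (2 : ℝ) ^ (2 * ε * φ.numVars) := by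
    rw [← Real.rpow_add two_pos]
    exact Real.rpow_le_rpow_of_exponent_le one_le_two (by nlinarith)
  calc ((mainF cap m' a b F₁ φ).length : ℝ)
      ≤ (F₁ φ.compact).length *
          (2 ^ IPRename.numCols k cap * ((((m' + 1) ^ (m / m') : ℕ) : ℝ) * (m' + 1))) := h1r
    _ ≤ (2 : ℝ) ^ (ε * m) * (2 ^ IPRename.numCols k cap * ((2 : ℝ) ^ (ε * m) * (m' + 1))) := by
        gcongr
        exact (hF₁ φ.compact).1
    _ = ((2 ^ IPRename.numCols k cap * (m' + 1) : ℕ) : ℝ) *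
          ((2 : ℝ) ^ (ε * m) * (2 : ℝ) ^ (ε * m)) := by
        push_cast; ring
    _ ≤ ((2 ^ IPRename.numCols k cap * (m' + 1) : ℕ) : ℝ) * (2 : ℝ) ^ (2 * ε * φ.numVars) := by
        gcongr

/-- **(ii) The number of variables of the disjuncts**: at most `(1 - δ/(3k)) n` when
`δ/(3k) ≤ a/b` and `δ ≤ 3k`.
[cite: ImpagliazzoPaturiJCSS2001, Lemma 2 (p. 373) ("on at most n(1 - δ/(ek)) variables")] -/
theorem numVars_le_of_mem_mainF (hF₁ : IsSparsifier ε C₁ F₁) (hb : 0 < b) {δ : ℝ}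
    (hr1 : δ / (3 * k) ≤ (a : ℝ) / b) (hcoef : 0 ≤ 1 - δ / (3 * k)) {φ : KCNF k}
    {Φ : KCNF (IPRename.kOut k cap m')} (hΦ : Φ ∈ mainF cap m' a b F₁ φ) :
    (Φ.numVars : ℝ) ≤ (1 - δ / (3 * k)) * φ.numVars := by
  obtain ⟨ψ, hψ, hΦ⟩ := (mem_mainF hF₁).1 hΦ
  set m := φ.compact.numVars with hmdef
  have h1 := IPRename.numVars_le_of_mem_reduceList hΦ
  rw [((hF₁ φ.compact).2.1 ψ hψ).1] at h1
  have hmn : (m : ℝ) ≤ φ.numVars := by exact_mod_cast KCNF.numVars_compact_le φ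
  by_cases htm : ipThreshold a b m ≤ m
  · have h2 : (Φ.numVars : ℝ) ≤ m - ipThreshold a b m := by
      rw [← Nat.cast_sub htm]; exact_mod_cast h1
    calc (Φ.numVars : ℝ) ≤ m - ipThreshold a b m := h2
      _ ≤ m - a / b * m := by linarith [ipThreshold_ge (a := a) hb m]
      _ = (1 - a / b) * m := by ring
      _ ≤ (1 - δ / (3 * k)) * m := mul_le_mul_of_nonneg_right (by linarith) (Nat.cast_nonneg _)
      _ ≤ (1 - δ / (3 * k)) * φ.numVars := mul_le_mul_of_nonneg_left hmn hcoef
  · have h2 : Φ.numVars = 0 := by omega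
    rw [h2, Nat.cast_zero]
    exact mul_nonneg hcoef (Nat.cast_nonneg _)

/-- The size of a sparse formula. [folklore] -/
theorem length_encode_le_of_mem_sparse (hF₁ : IsSparsifier ε C₁ F₁) {φ : KCNF k} {ψ : KCNF k}
    (hψ : ψ ∈ F₁ φ.compact) :
    ψ.encode.length ≤ 4 * (C₁ + 1) * (k + 3) * (φ.encode.length + 1) ^ 2 := by
  obtain ⟨hn, hc⟩ := (hF₁ φ.compact).2.1 ψ hψ
  exact length_encode_le_of_clauses ψ hn.le hc (KCNF.numVars_compact_le_length_encode φ)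

/-- **(iii) The size of the disjuncts** is polynomial in `L`. [folklore] -/
theorem length_encode_le_of_mem_mainF (hF₁ : IsSparsifier ε C₁ F₁) {φ : KCNF k}
    {Φ : KCNF (IPRename.kOut k cap m')} (hΦ : Φ ∈ mainF cap m' a b F₁ φ) :
    Φ.encode.length ≤ 4 * (2 ^ IPRename.kOut k cap m' * (C₁ + 1) + 1) *
      (IPRename.kOut k cap m' + 3) * (φ.encode.length + 1) ^ 2 := by
  obtain ⟨ψ, hψ, hΦ⟩ := (mem_mainF hF₁).1 hΦ
  obtain ⟨hn, hc⟩ := (hF₁ φ.compact).2.1 ψ hψ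
  obtain ⟨bs, -, fv, -, -, rfl⟩ := IPRename.mem_reduceList.1 hΦ
  set P : IPRename.Params := ⟨cap, m', IPRename.maskOf bs, fv⟩ with hPdef
  refine length_encode_le_of_clauses _ (m := φ.compact.numVars) ?_ ?_
    (KCNF.numVars_compact_le_length_encode φ)
  · rw [IPRename.numVars_reduce, hn]; exact Nat.sub_le _ _
  · have h1 := IPRename.length_clauses_reduce_le P ψ
    have h2 : IPRename.numBlocks P ψ.clauses ≤ φ.compact.numVars := by
      unfold IPRename.numBlocks
      have := IPRename.length_aList_add_length_bList P ψ.clauses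
      have := IPRename.card_occVars_le ψ
      omega
    calc (IPRename.reduce P ψ).clauses.length
        ≤ 2 ^ IPRename.kOut k cap m' * (ψ.clauses.length + IPRename.numBlocks P ψ.clauses) := h1
      _ ≤ 2 ^ IPRename.kOut k cap m' * (C₁ * φ.compact.numVars + φ.compact.numVars) := by gcongr
      _ = 2 ^ IPRename.kOut k cap m' * (C₁ + 1) * φ.compact.numVars := by ring

/-- **(iv) Correctness.** Under the hypothesis of Lemma 2, `φ` is satisfiable iff some disjunct
is: a satisfiable `φ` with no light satisfying assignment has, after compaction and
sparsification, a satisfiable sparse `ψ` whose minimal satisfying assignment has `≥ δ m` ones,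
all critical, of which at most `δ m / 20` are heavy (`cap ≥ 20 k C / δ`), so that a good mask
forces `≥ (k-1)^{k-1}/k^k · (19/20) δ m ≥ ⌈a m / b⌉` of them
(`IPRename.exists_satisfiable_mem_reduceList'`, `(a/b) k^k ≤ (19/20) δ (k-1)^{k-1}`).
[cite: ImpagliazzoPaturiJCSS2001, Lemma 2 (p. 373) and its proof sketch (p. 374)] -/
theorem satisfiable_iff_mainF (hF₁ : IsSparsifier ε C₁ F₁) (hk1 : 1 ≤ k) (hb : 0 < b) {δ : ℝ}
    (hδ : 0 < δ) (hcap : 20 * k * C₁ / δ ≤ (cap : ℝ))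
    (hr2 : (a : ℝ) / b * (k : ℝ) ^ k ≤ 19 / 20 * δ * ((k : ℝ) - 1) ^ (k - 1))
    {φ : KCNF k} (hno : φ.NoLightSat δ) :
    φ.Satisfiable ↔ ∃ Φ ∈ mainF cap m' a b F₁ φ, Φ.Satisfiable := by
  classical
  set m := φ.compact.numVars with hmdef
  constructor
  · intro hsat
    have hsat' : φ.compact.Satisfiable := (KCNF.satisfiable_compact_iff φ).2 hsat
    obtain ⟨v, hv⟩ := (IPRename.satisfiable_iff_exists _).1 hsat'
    obtain ⟨ψ, hψ, hψv⟩ := ((hF₁ φ.compact).2.2 v).1 hv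
    obtain ⟨hn, hc⟩ := (hF₁ φ.compact).2.1 ψ hψ
    have hψsat : ψ.Satisfiable := (IPRename.satisfiable_iff_exists _).2 ⟨v, hψv⟩
    obtain ⟨α, hmin, -⟩ := IPRename.exists_minimalSat ψ hψsat
    -- the ones of `α`: at least `δ m`
    have hno' : φ.compact.NoLightSat δ := KCNF.noLightSat_compact hδ.le hno
    have hαφ : φ.compact.eval α = true := ((hF₁ φ.compact).2.2 α).2 ⟨ψ, hψ, hmin.1⟩
    have hones : δ * m ≤ ((IPRename.onesBelow m α).card : ℝ) := by
      have h := hno' (fun i => α i) (by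
        unfold KCNF.evalFin
        rw [← hαφ]
        exact eval_congr_lt _ fun x hx => by simp [hx])
      rw [hammingNorm_restrict] at h
      exact_mod_cast h
    -- the heavy variables: at most `δ m / 20`
    have hheavy : ((IPRename.heavyVars ψ.clauses cap).card : ℝ) ≤ δ * m / 20 := by
      have h1 := (IPRename.card_heavyVars_mul_le ψ.clauses ψ.length_le cap).trans
        (Nat.mul_le_mul_left k hc)
      have h2 : ((cap : ℝ) + 1) * (IPRename.heavyVars ψ.clauses cap).card ≤ k * (C₁ * m) := by
        exact_mod_cast h1
      have h3 : 20 * k * C₁ ≤ δ * cap := by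
        have := (div_le_iff₀ hδ).1 hcap; linarith
      have hcap0 : (0 : ℝ) < (cap : ℝ) + 1 := by positivity
      have hm0 : (0 : ℝ) ≤ m := Nat.cast_nonneg _
      rw [le_div_iff₀ (by norm_num : (0 : ℝ) < 20)]
      refine le_of_mul_le_mul_left ?_ hcap0
      have hcard0 : (0 : ℝ) ≤ (IPRename.heavyVars ψ.clauses cap).card := Nat.cast_nonneg _
      nlinarith [mul_le_mul_of_nonneg_right h3 hm0]
    -- the light ones
    have hcrit : 19 / 20 * δ * m ≤ ((IPRename.critLight ψ.clauses cap α).card : ℝ) := by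
      have h2 : ((IPRename.onesBelow m α).card : ℝ) ≤
          (IPRename.critLight ψ.clauses cap α).card + (IPRename.heavyVars ψ.clauses cap).card := by
        exact_mod_cast IPRename.card_onesBelow_le ψ.clauses hmin m cap
      linarith
    -- the threshold is reached
    have hthr : k ^ k * ipThreshold a b m <
        (k - 1) ^ (k - 1) * (IPRename.critLight ψ.clauses cap α).card + k ^ k := by
      have hcast : (((k - 1 : ℕ) : ℝ)) = (k : ℝ) - 1 := by rw [Nat.cast_sub hk1, Nat.cast_one]
      have hkk : (0 : ℝ) < (k : ℝ) ^ k := by positivity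
      have hpos : (0 : ℝ) ≤ (((k - 1 : ℕ) : ℝ)) ^ (k - 1) := by positivity
      have hr2' : (a : ℝ) / b * (k : ℝ) ^ k ≤ 19 / 20 * δ * (((k - 1 : ℕ) : ℝ)) ^ (k - 1) := by
        rw [hcast]; exact hr2
      have h2 : (k : ℝ) ^ k * (ipThreshold a b m : ℝ) <
          (((k - 1 : ℕ) : ℝ)) ^ (k - 1) * ((IPRename.critLight ψ.clauses cap α).card : ℝ) +
            (k : ℝ) ^ k :=
        calc (k : ℝ) ^ k * (ipThreshold a b m : ℝ) < (k : ℝ) ^ k * (a / b * m + 1) :=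
              mul_lt_mul_of_pos_left (ipThreshold_lt (a := a) hb m) hkk
          _ = (a / b * (k : ℝ) ^ k) * m + (k : ℝ) ^ k := by ring
          _ ≤ (19 / 20 * δ * (((k - 1 : ℕ) : ℝ)) ^ (k - 1)) * m + (k : ℝ) ^ k :=
              add_le_add (mul_le_mul_of_nonneg_right hr2' (Nat.cast_nonneg _)) le_rfl
          _ = (((k - 1 : ℕ) : ℝ)) ^ (k - 1) * (19 / 20 * δ * m) + (k : ℝ) ^ k := by ring
          _ ≤ (((k - 1 : ℕ) : ℝ)) ^ (k - 1) * ((IPRename.critLight ψ.clauses cap α).card : ℝ) +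
                (k : ℝ) ^ k :=
              add_le_add (mul_le_mul_of_nonneg_left hcrit hpos) le_rfl
      exact_mod_cast h2
    obtain ⟨Φ, hΦ, hΦsat⟩ :=
      IPRename.exists_satisfiable_mem_reduceList' hk1 cap m' (ipThreshold a b m) ψ hmin hthr
    exact ⟨Φ, (mem_mainF hF₁).2 ⟨ψ, hψ, hΦ⟩, hΦsat⟩
  · rintro ⟨Φ, hΦ, hΦsat⟩
    obtain ⟨ψ, hψ, hΦ'⟩ := (mem_mainF hF₁).1 hΦ
    have hψsat := IPRename.satisfiable_of_mem_reduceList hΦ' hΦsat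
    obtain ⟨v, hv⟩ := (IPRename.satisfiable_iff_exists _).1 hψsat
    have : φ.compact.Satisfiable :=
      (IPRename.satisfiable_iff_exists _).2 ⟨v, ((hF₁ φ.compact).2.2 v).2 ⟨ψ, hψ, hv⟩⟩
    exact (KCNF.satisfiable_compact_iff φ).1 this

/-- **(v-a) Running time of the sparsifier on the compaction**: `O(2^{2εn} poly(L))`.
[folklore] -/
theorem isExpPolyDom_sparsifyTime (hε : 0 ≤ ε) {T₁ : ℕ → ℕ → ℕ} {c₁ : ℕ}
    (hc₁ : ∀ n L : ℕ, (T₁ n L : ℝ) ≤ c₁ * (2 : ℝ) ^ (ε * n) * ((L : ℝ) + 1) ^ c₁) :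
    KCNF.IsExpPolyDom (2 * ε) fun φ : KCNF k =>
      ((T₁ φ.compact.numVars φ.compact.encode.length : ℕ) : ℝ) := by
  refine ⟨c₁ * (4 * k + 13) ^ c₁, 2 * c₁, fun φ => ?_⟩
  have h1 := hc₁ φ.compact.numVars φ.compact.encode.length
  have hL' : (φ.compact.encode.length : ℝ) + 1 ≤ (4 * k + 13) * ((φ.encode.length : ℝ) + 1) ^ 2 := by
    have key : φ.compact.encode.length + 1 ≤ (4 * k + 13) * (φ.encode.length + 1) ^ 2 := by
      have h := KCNF.length_encode_compact_le φ
      have : (k + 3) * (φ.encode.length + 2) ^ 2 + 1 ≤ (4 * k + 13) * (φ.encode.length + 1) ^ 2 := by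
        nlinarith [Nat.zero_le (k * φ.encode.length), Nat.zero_le (φ.encode.length ^ 2),
          Nat.zero_le (k * φ.encode.length ^ 2)]
      omega
    exact_mod_cast key
  have hmn : (φ.compact.numVars : ℝ) ≤ φ.numVars := by exact_mod_cast KCNF.numVars_compact_le φ
  have h2 : (2 : ℝ) ^ (ε * φ.compact.numVars) ≤ (2 : ℝ) ^ (2 * ε * φ.numVars) :=
    Real.rpow_le_rpow_of_exponent_le one_le_two (by nlinarith)
  have h3 : ((φ.compact.encode.length : ℝ) + 1) ^ c₁ ≤
      ((4 * k + 13) * ((φ.encode.length : ℝ) + 1) ^ 2) ^ c₁ :=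
    pow_le_pow_left₀ (by positivity) hL' c₁
  have hc0 : (0 : ℝ) ≤ c₁ := Nat.cast_nonneg _
  calc ((T₁ φ.compact.numVars φ.compact.encode.length : ℕ) : ℝ)
      ≤ c₁ * (2 : ℝ) ^ (ε * φ.compact.numVars) * ((φ.compact.encode.length : ℝ) + 1) ^ c₁ := h1
    _ ≤ c₁ * (2 : ℝ) ^ (2 * ε * φ.numVars) * ((4 * k + 13) * ((φ.encode.length : ℝ) + 1) ^ 2) ^ c₁ :=
        mul_le_mul (mul_le_mul_of_nonneg_left h2 hc0) h3 (by positivity) (by positivity)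
    _ = ((c₁ * (4 * k + 13) ^ c₁ : ℕ) : ℝ) * (2 : ℝ) ^ (2 * ε * φ.numVars) *
          ((φ.encode.length : ℝ) + 1) ^ (2 * c₁) := by
        rw [mul_pow, ← pow_mul]; push_cast; ring

/-- The per-formula cost of the renaming machine on a list. [folklore] -/
def reduceCost (m' c₂ : ℕ) (l : List (KCNF k)) : ℕ :=
  c₂ * (l.map fun ψ : KCNF k => (max m' 1 + 1) ^ (ψ.numVars / max m' 1) *
    (ψ.encode.length + ψ.numVars + 1) ^ c₂).sum + c₂

/-- **(v-b) Running time of the renaming machine on the sparsified list**: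
`O(2^{2εn} poly(L))` (`2^{εm}` formulas, `(m'+1)^{m/m'} ≤ 2^{εm}` threshold vectors each,
polynomial size). [folklore] -/
theorem isExpPolyDom_reduceTime (hF₁ : IsSparsifier ε C₁ F₁) (hε : 0 ≤ ε) (hm'1 : 1 ≤ m')
    (hm' : ((m' : ℝ) + 1) ≤ (2 : ℝ) ^ (ε * m')) (c₂ : ℕ) :
    KCNF.IsExpPolyDom (2 * ε) fun φ : KCNF k => ((reduceCost m' c₂ (F₁ φ.compact) : ℕ) : ℝ) := by
  have hmax : max m' 1 = m' := max_eq_left hm'1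
  set E : ℕ := 4 * (C₁ + 1) * (k + 3) + 2 with hE
  refine ⟨c₂ * E ^ c₂ + c₂, 2 * c₂, fun φ => ?_⟩
  set m := φ.compact.numVars with hmdef
  set L := φ.encode.length with hLdef
  set w : KCNF k → ℕ := fun ψ => (max m' 1 + 1) ^ (ψ.numVars / max m' 1) *
    (ψ.encode.length + ψ.numVars + 1) ^ c₂ with hwdef
  have hw : ∀ ψ ∈ F₁ φ.compact, w ψ ≤ (m' + 1) ^ (m / m') * (E * (L + 1) ^ 2) ^ c₂ := by
    intro ψ hψ
    obtain ⟨hn, hc⟩ := (hF₁ φ.compact).2.1 ψ hψ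
    simp only [hwdef, hmax, hn]
    refine Nat.mul_le_mul_left _ (Nat.pow_le_pow_left ?_ _)
    have h1 := length_encode_le_of_mem_sparse hF₁ hψ
    have h2 : m ≤ L := KCNF.numVars_compact_le_length_encode φ
    have h3 : L + 1 ≤ (L + 1) ^ 2 := Nat.le_self_pow two_ne_zero _
    rw [← hLdef] at h1
    nlinarith
  have hsum : ((F₁ φ.compact).map w).sum ≤
      (F₁ φ.compact).length * ((m' + 1) ^ (m / m') * (E * (L + 1) ^ 2) ^ c₂) := by
    have := List.sum_le_card_nsmul ((F₁ φ.compact).map w)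
      ((m' + 1) ^ (m / m') * (E * (L + 1) ^ 2) ^ c₂) (fun x hx => by
        obtain ⟨ψ, hψ, rfl⟩ := List.mem_map.1 hx; exact hw ψ hψ)
    simpa using this
  have hsumr : ((((F₁ φ.compact).map w).sum : ℕ) : ℝ) ≤ (F₁ φ.compact).length *
      ((((m' + 1) ^ (m / m') : ℕ) : ℝ) * ((E : ℝ) ^ c₂ * ((L : ℝ) + 1) ^ (2 * c₂))) := by
    have e : (((E * (L + 1) ^ 2) ^ c₂ : ℕ) : ℝ) = (E : ℝ) ^ c₂ * ((L : ℝ) + 1) ^ (2 * c₂) := by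
      push_cast; rw [mul_pow, ← pow_mul]
    rw [← e]
    exact_mod_cast hsum
  have h2 : (((m' + 1) ^ (m / m') : ℕ) : ℝ) ≤ (2 : ℝ) ^ (ε * m) := blockCount_le hε hm'1 hm' m
  have hmn : (m : ℝ) ≤ φ.numVars := by exact_mod_cast KCNF.numVars_compact_le φ
  have h3 : (2 : ℝ) ^ (ε * m) * (2 : ℝ) ^ (ε * m) ≤ (2 : ℝ) ^ (2 * ε * φ.numVars) := by
    rw [← Real.rpow_add two_pos]
    exact Real.rpow_le_rpow_of_exponent_le one_le_two (by nlinarith)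
  set X : ℝ := (2 : ℝ) ^ (2 * ε * φ.numVars) * ((L : ℝ) + 1) ^ (2 * c₂) with hX
  have hX1 : 1 ≤ X :=
    one_le_mul_of_one_le_of_one_le (one_le_two_rpow (by positivity)) (one_le_pow₀ (by simp))
  have hmain : ((((F₁ φ.compact).map w).sum : ℕ) : ℝ) ≤ (E : ℝ) ^ c₂ * X := by
    calc _ ≤ (F₁ φ.compact).length *
          ((((m' + 1) ^ (m / m') : ℕ) : ℝ) * ((E : ℝ) ^ c₂ * ((L : ℝ) + 1) ^ (2 * c₂))) := hsumr
      _ ≤ (2 : ℝ) ^ (ε * m) * ((2 : ℝ) ^ (ε * m) * ((E : ℝ) ^ c₂ * ((L : ℝ) + 1) ^ (2 * c₂))) := by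
          gcongr
          exact (hF₁ φ.compact).1
      _ = (E : ℝ) ^ c₂ * (((2 : ℝ) ^ (ε * m) * (2 : ℝ) ^ (ε * m)) * ((L : ℝ) + 1) ^ (2 * c₂)) := by
          ring
      _ ≤ (E : ℝ) ^ c₂ * X := by rw [hX]; gcongr
  have hc2 : (0 : ℝ) ≤ c₂ := Nat.cast_nonneg _
  have hgoal : ((reduceCost m' c₂ (F₁ φ.compact) : ℕ) : ℝ) =
      c₂ * ((((F₁ φ.compact).map w).sum : ℕ) : ℝ) + c₂ := by
    simp only [reduceCost, hwdef]; push_cast; ring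
  show ((reduceCost m' c₂ (F₁ φ.compact) : ℕ) : ℝ) ≤ _
  rw [hgoal]
  calc (c₂ : ℝ) * ((((F₁ φ.compact).map w).sum : ℕ) : ℝ) + c₂
      ≤ c₂ * ((E : ℝ) ^ c₂ * X) + c₂ * X :=
        add_le_add (mul_le_mul_of_nonneg_left hmain hc2) (le_mul_of_one_le_right hc2 hX1)
    _ = ((c₂ * E ^ c₂ + c₂ : ℕ) : ℝ) * (2 : ℝ) ^ (2 * ε * φ.numVars) * ((L : ℝ) + 1) ^ (2 * c₂) := by
        rw [hX]; push_cast; ring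

end MainCase

/-- **Lemma 2 for `0 < δ ≤ 1`** from the three machine facts: compaction
(`kCNF_compact_computable`), sparsification (`Literature.Computability.FineGrained.sparsification`,
**fine-grained.S05**), and the renaming reduction (`ipRename_reduceList_computable`), with the
parameters: block length `m'` with `m' + 1 ≤ 2^{ε m'}`; sparsification constant `ε`;
`cap = ⌈20 k C₁ / δ⌉`; threshold ratio `a/b ∈ [δ/(3k), 19 δ/(20 e k)]` (`exists_ratio`).
[cite: ImpagliazzoPaturiJCSS2001, Lemma 2 (p. 373) and its proof sketch (p. 374)] -/
theorem lemma2_of_le_one (h₀ : kCNF_compact_computable) (h₁ : sparsification)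
    (h₂ : ipRename_reduceList_computable) {k : ℕ} (hk : 3 ≤ k) {δ ε : ℝ} (hδ : 0 < δ)
    (hδ1 : δ ≤ 1) (hε : 0 < ε) :
    ∃ (k' C : ℕ) (F : KCNF k → List (KCNF k')) (T : ℕ → ℕ → ℕ),
      IsExpPolyBound (2 * ε) T ∧
      ComputesInTime KCNF.encode KCNF.encodeList F (fun φ => T φ.numVars φ.encode.length) ∧
      ∀ φ : KCNF k,
        ((F φ).length : ℝ) ≤
            C * (2 : ℝ) ^ (2 * ε * φ.numVars) * ((φ.encode.length : ℝ) + 1) ^ C ∧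
        (∀ ψ ∈ F φ, (ψ.numVars : ℝ) ≤ (1 - δ / (3 * k)) * φ.numVars ∧
          (ψ.encode.length : ℝ) ≤ C * ((φ.encode.length : ℝ) + 1) ^ C) ∧
        (φ.NoLightSat δ → (φ.Satisfiable ↔ ∃ ψ ∈ F φ, ψ.Satisfiable)) := by
  have hk1 : 1 ≤ k := by omega
  have hε0 : 0 ≤ ε := hε.le
  have hcoef : 0 ≤ 1 - δ / (3 * k) := by
    have hk0 : (0 : ℝ) < k := by exact_mod_cast (show 0 < k by omega)
    rw [sub_nonneg, div_le_one (by positivity)]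
    have : (3 : ℝ) ≤ k := by exact_mod_cast hk
    linarith
  /- parameters -/
  obtain ⟨m', hm'1, hm'⟩ := exists_blockLen hε
  obtain ⟨C₁, F₁, T₁, hF₁, ⟨c₁, hc₁⟩, hM₁⟩ := h₁ k ε hε
  obtain ⟨a, b, hb, hr1, hr2⟩ := exists_ratio hk hδ
  set cap : ℕ := ⌈20 * k * C₁ / δ⌉₊ with hcapdef
  have hcap : 20 * k * C₁ / δ ≤ (cap : ℝ) := Nat.le_ceil _
  obtain ⟨c₀, hM₀⟩ := h₀ k
  obtain ⟨c₂, hM₂⟩ := h₂ k cap m' a b hb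
  set k' : ℕ := IPRename.kOut k cap m' with hk'def
  set Cbig : ℕ := 2 ^ IPRename.numCols k cap * (m' + 1) +
    4 * (2 ^ k' * (C₁ + 1) + 1) * (k' + 3) + 2 with hCbig
  /- the machine and its running time -/
  have hM : ComputesInTime KCNF.encode KCNF.encodeList (mainF cap m' a b F₁) fun φ =>
      reduceCost m' c₂ (F₁ φ.compact) +
      (T₁ φ.compact.numVars φ.compact.encode.length + c₀ * (φ.encode.length + 1) ^ c₀) :=
    (hM₀.comp hM₁).comp hM₂
  have p0 : KCNF.IsExpPolyDom (2 * ε) fun φ : KCNF k =>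
      ((c₀ * (φ.encode.length + 1) ^ c₀ : ℕ) : ℝ) := by
    refine ⟨c₀, c₀, fun φ => ?_⟩
    have h1 : (1 : ℝ) ≤ (2 : ℝ) ^ (2 * ε * φ.numVars) := one_le_two_rpow (by positivity)
    have h2 : (0 : ℝ) ≤ c₀ * ((φ.encode.length : ℝ) + 1) ^ c₀ := by positivity
    push_cast
    nlinarith
  have hTdom : KCNF.IsExpPolyDom (2 * ε) fun φ : KCNF k =>
      ((reduceCost m' c₂ (F₁ φ.compact) +
        (T₁ φ.compact.numVars φ.compact.encode.length + c₀ * (φ.encode.length + 1) ^ c₀) : ℕ) : ℝ) :=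
    ((isExpPolyDom_reduceTime hF₁ hε0 hm'1 hm' c₂).add
      ((isExpPolyDom_sparsifyTime hε0 hc₁).add p0)).of_le fun φ => by push_cast; exact le_rfl
  obtain ⟨T, hT, hMT⟩ := exists_expPolyBound_of_isExpPolyDom hTdom hM
  /- assembling -/
  refine ⟨k', Cbig, mainF cap m' a b F₁, T, hT, hMT, fun φ => ⟨?_, fun Φ hΦ =>
    ⟨numVars_le_of_mem_mainF hF₁ hb hr1 hcoef hΦ, ?_⟩,
    fun hno => satisfiable_iff_mainF hF₁ hk1 hb hδ hcap hr2 hno⟩⟩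
  · have h1 : (1 : ℝ) ≤ ((φ.encode.length : ℝ) + 1) ^ Cbig := one_le_pow₀ (by simp)
    have h2 : ((2 ^ IPRename.numCols k cap * (m' + 1) : ℕ) : ℝ) ≤ Cbig := by
      rw [hCbig]; exact_mod_cast (by omega)
    have h3 : (0 : ℝ) ≤ (2 : ℝ) ^ (2 * ε * φ.numVars) := by positivity
    calc ((mainF cap m' a b F₁ φ).length : ℝ)
        ≤ ((2 ^ IPRename.numCols k cap * (m' + 1) : ℕ) : ℝ) * (2 : ℝ) ^ (2 * ε * φ.numVars) :=
          length_mainF_le hF₁ hε0 hm'1 hm' φ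
      _ ≤ Cbig * (2 : ℝ) ^ (2 * ε * φ.numVars) := mul_le_mul_of_nonneg_right h2 h3
      _ ≤ Cbig * (2 : ℝ) ^ (2 * ε * φ.numVars) * ((φ.encode.length : ℝ) + 1) ^ Cbig :=
          le_mul_of_one_le_right (by positivity) h1
  · have h1 : (Φ.encode.length : ℝ) ≤
        ((4 * (2 ^ k' * (C₁ + 1) + 1) * (k' + 3) : ℕ) : ℝ) * ((φ.encode.length : ℝ) + 1) ^ 2 := by
      exact_mod_cast length_encode_le_of_mem_mainF hF₁ hΦ
    have h2 : ((4 * (2 ^ k' * (C₁ + 1) + 1) * (k' + 3) : ℕ) : ℝ) ≤ Cbig := by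
      rw [hCbig]; exact_mod_cast (by omega)
    have h3 : ((φ.encode.length : ℝ) + 1) ^ 2 ≤ ((φ.encode.length : ℝ) + 1) ^ Cbig :=
      pow_le_pow_right₀ (by simp) (by rw [hCbig]; omega)
    calc (Φ.encode.length : ℝ)
        ≤ ((4 * (2 ^ k' * (C₁ + 1) + 1) * (k' + 3) : ℕ) : ℝ) * ((φ.encode.length : ℝ) + 1) ^ 2 := h1
      _ ≤ Cbig * ((φ.encode.length : ℝ) + 1) ^ Cbig := by
          gcongr

/-! ### Lemma 2 from the machine facts -/

/-- **Impagliazzo–Paturi 2001, Lemma 2** (the named fact `impagliazzoPaturi_lemma2` of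
`KSatExponentGap.lean`) **from the three machine facts** `kCNF_compact_computable`,
`sparsification` (fine-grained.S05) and `ipRename_reduceList_computable`: the case `δ > 1` is
degenerate (`lemma2_of_one_lt`), the case `δ ≤ 1` is `lemma2_of_le_one`.
[cite: ImpagliazzoPaturiJCSS2001, Lemma 2 (p. 373)] -/
theorem impagliazzoPaturi_lemma2_of (h₀ : kCNF_compact_computable) (h₁ : sparsification)
    (h₂ : ipRename_reduceList_computable) : impagliazzoPaturi_lemma2 := by
  intro k hk δ ε hδ hε
  by_cases hδ1 : δ ≤ 1
  · exact lemma2_of_le_one h₀ h₁ h₂ hk hδ hδ1 hε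
  · exact lemma2_of_one_lt k (not_le.1 hδ1) hε

/-- **Theorem 3 of Impagliazzo–Paturi 2001 from the machine facts**, through the assembly
`satExponent_le_satExponentLimit_of` of `KSatExponentGap.lean` (which keeps
`kSATInExpTime_one` and `lightKSAT_exhaustiveSearch`, both discharged in the tree, as
hypotheses). [cite: ImpagliazzoPaturiJCSS2001, Theorem 3 (p. 374)] -/
theorem satExponent_le_satExponentLimit_of_machines (h₁ : kSATInExpTime_one)
    (h₂ : lightKSAT_exhaustiveSearch) (h₀ : kCNF_compact_computable) (h₃ : sparsification)
    (h₄ : ipRename_reduceList_computable) : satExponent_le_satExponentLimit :=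
  satExponent_le_satExponentLimit_of h₁ h₂ (impagliazzoPaturi_lemma2_of h₀ h₃ h₄)

end IPLemma2

end Literature.Computability.FineGrained
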